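import Summits.SmoothPoincare4.SmoothPoincare4.Theses.InformationMetricHadamard
import Literature.Geometry.Lorentzian.IsometryProofs

/-!
# Hardness record for line `Sketch` of crux `InformationMetricHadamard.C0AhRecognition`

`standardSectionConeCollar_of_c0AhRecognition`: the crux implies the transfer stub
`stub_standardSectionConeCollar` (same binders, same conclusion), by transporting the given collar
`Φ` over `(Σ, g)` along the diffeomorphism `Σ ≅ S⁴` that the crux provides: `Ψ := Φ ∘ (e⁻¹ × id)`,
`gN := (e⁻¹)^* g`. Together with the kernel-checked composition
`stub_twoCollarConformality → stub_standardSectionConeCollar → C0AhRecognition` of the skeleton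
this certifies that the transfer stub is crux-EQUIVALENT modulo the (classical) first lemma: it
cannot be landed short of settling the crux itself. Pure bookkeeping (chain rule, images of
products); no `sorry`.
-/

noncomputable section

-- the prescribed namespace `Summit.<P>.<Sub>.…` duplicates `SmoothPoincare4` (P = Sub)
set_option linter.dupNamespace false

open scoped Manifold ContDiff Topology ENNReal NNReal
open Set Function

namespace Summit.SmoothPoincare4.SmoothPoincare4.Cruxes.C0AhRecognition.Sketch

open Literature.Topology.FourManifolds (HomotopySphere)
open Literature.Geometry.Lorentzian (PseudoRiemannianMetric pullbackBilin pullbackBilin_apply)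

/-- Model space `ℝ⁴` of the cross-sections. -/
local notation "E4" => EuclideanSpace ℝ (Fin 4)
/-- Model space `ℝ⁵` of the filling. -/
local notation "E5" => EuclideanSpace ℝ (Fin 5)

section Transport

/-- The differentials of a `C^∞` diffeomorphism are injective. [folklore] -/
theorem mfderiv_injective_of_diffeomorph
    {N : Type} [TopologicalSpace N] [ChartedSpace E4 N]
    {N' : Type} [TopologicalSpace N'] [ChartedSpace E4 N']
    (f : N' ≃ₘ⟮𝓡 4, 𝓡 4⟯ N) (y : N') :
    Injective (mfderiv (𝓡 4) (𝓡 4) f y) :=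
  (f.mfderivToContinuousLinearEquiv (by simp) y).injective

/-- Images of vertical strips are unchanged by precomposing the collar with `f × id` for a
surjective `f`. [folklore] -/
theorem image_comp_prodMap_univ_prod {N N' W : Type} (Φ : N × ℝ → W) {f : N' → N}
    (hf : Surjective f) (s : Set ℝ) :
    (Φ ∘ Prod.map f id) '' (univ ×ˢ s) = Φ '' (univ ×ˢ s) := by
  rw [image_comp, prodMap_image_prod, image_univ_of_surjective hf, image_id]

/-- **Chain rule for the transported collar**: `d(Φ ∘ (f × id))_{(y,l)} (v, s) =
dΦ_{(f y, l)} (df_y v, s)` at points of the open strip where `Φ` is smooth. [folklore] -/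
theorem mfderiv_comp_prodMap_apply
    {N : Type} [TopologicalSpace N] [ChartedSpace E4 N] [IsManifold (𝓡 4) ∞ N]
    {N' : Type} [TopologicalSpace N'] [ChartedSpace E4 N'] [IsManifold (𝓡 4) ∞ N']
    {W : Type} [TopologicalSpace W] [ChartedSpace E5 W] [IsManifold (𝓡 5) ∞ W]
    (Φ : N × ℝ → W) (f : N' ≃ₘ⟮𝓡 4, 𝓡 4⟯ N)
    (hsm : ContMDiffOn ((𝓡 4).prod 𝓘(ℝ, ℝ)) (𝓡 5) ∞ Φ (univ ×ˢ Ioo (0 : ℝ) 1))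
    (y : N') {l : ℝ} (hl : l ∈ Ioo (0 : ℝ) 1) (v : TangentSpace (𝓡 4) y) (s : ℝ) :
    mfderiv ((𝓡 4).prod 𝓘(ℝ, ℝ)) (𝓡 5) (Φ ∘ Prod.map f id) (y, l) (v, s) =
      mfderiv ((𝓡 4).prod 𝓘(ℝ, ℝ)) (𝓡 5) Φ (f y, l) (mfderiv (𝓡 4) (𝓡 4) f y v, s) := by
  have hΩo : IsOpen (univ ×ˢ Ioo (0 : ℝ) 1 : Set (N × ℝ)) := isOpen_univ.prod isOpen_Ioo
  have hmem : (f y, l) ∈ (univ ×ˢ Ioo (0 : ℝ) 1 : Set (N × ℝ)) := ⟨mem_univ _, hl⟩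
  have hΦ : MDifferentiableAt ((𝓡 4).prod 𝓘(ℝ, ℝ)) (𝓡 5) Φ (Prod.map f id (y, l)) :=
    ((hsm.contMDiffAt (hΩo.mem_nhds hmem)).mdifferentiableAt (by simp))
  have hf : MDifferentiableAt (𝓡 4) (𝓡 4) f y := f.contMDiff.mdifferentiableAt (by simp)
  have hid : MDifferentiableAt 𝓘(ℝ, ℝ) 𝓘(ℝ, ℝ) (id : ℝ → ℝ) l := mdifferentiableAt_id
  have hP : MDifferentiableAt ((𝓡 4).prod 𝓘(ℝ, ℝ)) ((𝓡 4).prod 𝓘(ℝ, ℝ)) (Prod.map f id) (y, l) :=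
    hf.prodMap hid
  rw [mfderiv_comp (y, l) hΦ hP, mfderiv_prodMap hf hid, mfderiv_id]
  rfl

end Transport

/-- **Hardness record.** The crux `C0AhRecognition` implies the transfer stub
`stub_standardSectionConeCollar` with the same binders: given the crux, the diffeomorphism
`e : Σ ≅ S⁴` it produces transports the collar, `Ψ := Φ ∘ (e⁻¹ × id)` and `gN := (e⁻¹)^* g`
(`PseudoRiemannianMetric.comap`, smoothness by `contMDiff_pullbackBilin_holds`), and every clause
is invariant: images of vertical strips are unchanged, injectivity composes, and the asymptotics
clause at `(y, l, v, s)` is the given one at `(e⁻¹ y, l, d(e⁻¹) v, s)` by the chain rule. Hence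
the stub is at least as strong as the crux. [folklore] -/
theorem standardSectionConeCollar_of_c0AhRecognition
    (hR : Summit.SmoothPoincare4.SmoothPoincare4.Theses.InformationMetricHadamard.C0AhRecognition)
    (S : HomotopySphere 4)
    (g : PseudoRiemannianMetric (𝓡 4) ∞ (EuclideanSpace ℝ (Fin 4)) (TangentSpace (𝓡 4) : S.carrier → Type _))
    (hg : g.IsRiemannian)
    (W : Type) [TopologicalSpace W] [T2Space W] [SecondCountableTopology W]
    [ChartedSpace (EuclideanSpace ℝ (Fin 5)) W] [IsManifold (𝓡 5) ∞ W] [SimplyConnectedSpace W]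
    (G : PseudoRiemannianMetric (𝓡 5) ∞ (EuclideanSpace ℝ (Fin 5)) (TangentSpace (𝓡 5) : W → Type _))
    (hG : G.IsRiemannian) (c : ℝ) (Φ : S.carrier × ℝ → W) (hc : 0 < c)
    (hcpt : ∀ (x : W) (r : NNReal), IsCompact {y : W | G.edist hG x y ≤ r})
    (hsec : ∀ cov, G.IsLeviCivita cov →
      ∀ (x : W) (X Y : TangentSpace (𝓡 5) x), G.sectionalCurvature cov x X Y ≤ 0)
    (hsm : ContMDiffOn ((𝓡 4).prod 𝓘(ℝ, ℝ)) (𝓡 5) ∞ Φ (univ ×ˢ Ioo (0 : ℝ) 1))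
    (hinj : InjOn Φ (univ ×ˢ Ioo (0 : ℝ) 1))
    (hco : ∀ t ∈ Ioo (0 : ℝ) 1, IsCompact (Φ '' (univ ×ˢ Ioo (0 : ℝ) t))ᶜ)
    (hcl : ∀ t ∈ Ioo (0 : ℝ) 1, closure (Φ '' (univ ×ˢ Ioo (0 : ℝ) t)) ⊆ Φ '' (univ ×ˢ Ioo (0 : ℝ) 1))
    (hasym : ∀ ε : ℝ, 0 < ε → ∃ t ∈ Ioo (0 : ℝ) 1, ∀ (x : S.carrier) (l : ℝ), l ∈ Ioo (0 : ℝ) t →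
      ∀ (v : TangentSpace (𝓡 4) x) (s : ℝ),
        |G.val (Φ (x, l)) (mfderiv ((𝓡 4).prod 𝓘(ℝ, ℝ)) (𝓡 5) Φ (x, l) (v, s))
            (mfderiv ((𝓡 4).prod 𝓘(ℝ, ℝ)) (𝓡 5) Φ (x, l) (v, s)) -
          c * (s ^ 2 + g.val x v v) / l ^ 2| ≤ ε * (c * (s ^ 2 + g.val x v v) / l ^ 2)) :
    ∃ (gN : PseudoRiemannianMetric (𝓡 4) ∞ (EuclideanSpace ℝ (Fin 4))
        (TangentSpace (𝓡 4) : (Metric.sphere (0 : EuclideanSpace ℝ (Fin 5)) 1) → Type _))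
      (_ : gN.IsRiemannian) (c' : ℝ) (Ψ : (Metric.sphere (0 : EuclideanSpace ℝ (Fin 5)) 1) × ℝ → W),
      0 < c' ∧
      ContMDiffOn ((𝓡 4).prod 𝓘(ℝ, ℝ)) (𝓡 5) ∞ Ψ (univ ×ˢ Ioo (0 : ℝ) 1) ∧
      InjOn Ψ (univ ×ˢ Ioo (0 : ℝ) 1) ∧
      (∀ t ∈ Ioo (0 : ℝ) 1, IsCompact (Ψ '' (univ ×ˢ Ioo (0 : ℝ) t))ᶜ) ∧
      (∀ t ∈ Ioo (0 : ℝ) 1, closure (Ψ '' (univ ×ˢ Ioo (0 : ℝ) t)) ⊆ Ψ '' (univ ×ˢ Ioo (0 : ℝ) 1)) ∧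
      (∀ ε : ℝ, 0 < ε → ∃ t ∈ Ioo (0 : ℝ) 1,
        ∀ (y : (Metric.sphere (0 : EuclideanSpace ℝ (Fin 5)) 1)) (l : ℝ), l ∈ Ioo (0 : ℝ) t →
        ∀ (v : TangentSpace (𝓡 4) y) (s : ℝ),
          |G.val (Ψ (y, l)) (mfderiv ((𝓡 4).prod 𝓘(ℝ, ℝ)) (𝓡 5) Ψ (y, l) (v, s))
              (mfderiv ((𝓡 4).prod 𝓘(ℝ, ℝ)) (𝓡 5) Ψ (y, l) (v, s)) -
            c' * (s ^ 2 + gN.val y v v) / l ^ 2| ≤ ε * (c' * (s ^ 2 + gN.val y v v) / l ^ 2)) := by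
  obtain ⟨e⟩ := hR S g hg W G hG c Φ hc hcpt hsec hsm hinj hco hcl hasym
  -- `f := e⁻¹ : S⁴ → Σ`, a diffeomorphism; `gN := f^* g`, `Ψ := Φ ∘ (f × id)`
  set f : (Metric.sphere (0 : EuclideanSpace ℝ (Fin 5)) 1) ≃ₘ⟮𝓡 4, 𝓡 4⟯ S.carrier := e.symm
    with hf
  have hfinj : ∀ y, Injective (mfderiv (𝓡 4) (𝓡 4) f y) := mfderiv_injective_of_diffeomorph f
  have hfs : Surjective (f : (Metric.sphere (0 : EuclideanSpace ℝ (Fin 5)) 1) → S.carrier) :=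
    EquivLike.surjective f
  have hfi : Injective (f : (Metric.sphere (0 : EuclideanSpace ℝ (Fin 5)) 1) → S.carrier) :=
    EquivLike.injective f
  let gN : PseudoRiemannianMetric (𝓡 4) ∞ (EuclideanSpace ℝ (Fin 4))
      (TangentSpace (𝓡 4) : (Metric.sphere (0 : EuclideanSpace ℝ (Fin 5)) 1) → Type _) :=
    g.comap Literature.Geometry.Lorentzian.PseudoRiemannianMetric.contMDiff_pullbackBilin_holds
      f f.contMDiff hfinj rfl
  have hgNval : ∀ (y : (Metric.sphere (0 : EuclideanSpace ℝ (Fin 5)) 1))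
      (v w : TangentSpace (𝓡 4) y),
      gN.val y v w = g.val (f y) (mfderiv (𝓡 4) (𝓡 4) f y v) (mfderiv (𝓡 4) (𝓡 4) f y w) :=
    fun y v w ↦ rfl
  have hgN : gN.IsRiemannian := by
    intro y v hv
    rw [hgNval]
    refine hg (f y) _ fun h ↦ hv (hfinj y ?_)
    rw [h, map_zero]
  refine ⟨gN, hgN, c, Φ ∘ Prod.map f id, hc, ?_, ?_, ?_, ?_, ?_⟩
  · -- smoothness on the strip
    refine hsm.comp ((f.contMDiff.prodMap contMDiff_id).contMDiffOn) ?_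
    rintro ⟨y, l⟩ ⟨-, hl⟩
    exact ⟨mem_univ _, hl⟩
  · -- injectivity on the strip
    rintro ⟨y, l⟩ ⟨-, hl⟩ ⟨y', l'⟩ ⟨-, hl'⟩ hyl
    have h := hinj ⟨mem_univ _, hl⟩ ⟨mem_univ _, hl'⟩ hyl
    simp only [Prod.map, id_eq, Prod.mk.injEq] at h
    rw [hfi h.1, h.2]
  · -- far parts co-compact
    intro t ht
    rw [image_comp_prodMap_univ_prod Φ hfs]
    exact hco t ht
  · -- closure clause
    intro t ht
    rw [image_comp_prodMap_univ_prod Φ hfs, image_comp_prodMap_univ_prod Φ hfs]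
    exact hcl t ht
  · -- asymptotics: the given clause at `(f y, l, df v, s)`
    intro ε hε
    obtain ⟨t, ht, H⟩ := hasym ε hε
    refine ⟨t, ht, fun y l hl v s ↦ ?_⟩
    have hl1 : l ∈ Ioo (0 : ℝ) 1 := ⟨hl.1, hl.2.trans ht.2⟩
    rw [mfderiv_comp_prodMap_apply Φ f hsm y hl1 v s, hgNval]
    exact H (f y) l hl _ s

end Summit.SmoothPoincare4.SmoothPoincare4.Cruxes.C0AhRecognition.Sketch

end
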